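import Mathlib.Tactic.DeriveCountable
import Literature.Computability.Complexity.TimeBounds
import Literature.Computability.Complexity.TimeBoundsProofs
import Literature.Computability.Complexity.Oracle
import HarnessLib

/-!
# Polynomial-time computable functions form a countable set (trunk `CplxCore`)

Main results:

* `Literature.Computability.Complexity.TM2Std.stdCode`, `Literature.Computability.Complexity.TM2Std.outputs_tr` (and the bundled form
  `TM2Std.stdIndex` / `TM2Std.computes_stdIndex`): every bundled machine
  `M : Turing.TM2ComputableAux Γ₀ Γ₁` is simulated step for step by a **standard machine** — one
  whose stack index type, label type, state type and (single, shared) stack alphabet are all of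
  the form `Fin _` — along a recoding of its finitely many *reachable* stack symbols (the input
  alphabet together with the symbols pushed by some statement of the program);
* `Literature.Computability.Complexity.TM2Std.outputs_unique`: a deterministic machine has at most one output word;
* `Literature.Computability.Complexity.countable_setOf_timeComputable`, `Literature.Computability.Complexity.countable_setOf_polyTimeComputable`:
  for a countable output alphabet `Γ₁` and an injective output encoder `eb`, the set of functions
  `f : α → β` computed by some machine within some time bound (resp. `PolyTimeComputable ea eb f`)
  is countable (the input alphabet `Γ₀` is automatically finite as soon as one machine exists);
* `Literature.Computability.Complexity.countable_setOf_isPolyTime`: there are countably many polynomial-time oracle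
  algorithms (`OracleAlg.IsPolyTime`).

This is the formal content of "every Turing machine can be represented by a string" (Arora–Barak
2009, §1.4; the enumeration `M₁, M₂, …` of machines underlying every diagonalization
argument, e.g. Baker–Gill–Solovay 1975, §1, Ko 1989, §3) for Mathlib's model `Turing.FinTM2`,
whose machines form a proper class-sized `Type 1` (the index, label, state and symbol types are
arbitrary types carrying `Fintype` instances — and the stack alphabets other than the input one
need not even be finite), so that countability is a theorem about the *computed functions* and
needs the reduction to standard machines. Mathlib has no such result (it has the relabelling
`Turing.TM0.Machine.map` for the `TM0` model only).

## Proof sketch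

Given `M`, let `A ⊆ Σ k, Γ k` be the set of *allowed* symbols: all symbols of the input stack
`k₀` and every `⟨k, f s⟩` for a statement `push k f _` occurring in the program; `A` is finite.
Number `A` injectively by `1, …, N` (`enc`, with `0` for everything else) and choose bijections
of `K`, `Λ`, `σ` with `Fin _`. The standard machine runs the translated program (`trStmt`:
`push` pushes the code of the pushed symbol, `peek`/`pop` decode the top code back to a symbol
before calling the original transition). On configurations all of whose stack symbols are
allowed — an invariant of runs from `initList` — one step of `M` is matched by one step of the
standard machine on the coded configuration (`step_tr`), hence halting runs and their outputs
correspond (`outputs_tr`). A standard machine together with the coding of `Γ₀` and the partial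
decoding into `Γ₁` is an element of a countable type (`StdIndex`), and determines the computed
function when `eb` is injective (`outputs_unique`).

## References

* S. Arora, B. Barak, *Computational Complexity: A Modern Approach* (2009), §1.4
  ("Machines as strings and the universal Turing machine"), §3.4.
* T. Baker, J. Gill, R. Solovay, *Relativizations of the P =? NP question*, SIAM J. Comput. 4
  (1975), §1.
* Mathlib, `Mathlib/Computability/TuringMachine/StackTuringMachine.lean`, `…/Computable.lean`.
-/

namespace Literature.Computability.Complexity

open Turing StateTransition Function

namespace TM2Std

/-! ### Standard statements and standard machines -/

/-- Statements of a **standard machine** with `nK` stacks over the shared alphabet `Fin (N+1)`,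
`nΛ` labels and `nσ` states: the constructors of `Turing.TM2.Stmt` with all types `Fin _`
(a first-order syntax, so that the type is countable). [cite: AroraBarak2009, §1.4] -/
inductive SStmt (nK N nΛ nσ : ℕ) : Type
  | push : Fin nK → (Fin nσ → Fin (N + 1)) → SStmt nK N nΛ nσ → SStmt nK N nΛ nσ
  | peek : Fin nK → (Fin nσ → Option (Fin (N + 1)) → Fin nσ) → SStmt nK N nΛ nσ → SStmt nK N nΛ nσ
  | pop : Fin nK → (Fin nσ → Option (Fin (N + 1)) → Fin nσ) → SStmt nK N nΛ nσ → SStmt nK N nΛ nσ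
  | load : (Fin nσ → Fin nσ) → SStmt nK N nΛ nσ → SStmt nK N nΛ nσ
  | branch : (Fin nσ → Bool) → SStmt nK N nΛ nσ → SStmt nK N nΛ nσ → SStmt nK N nΛ nσ
  | goto : (Fin nσ → Fin nΛ) → SStmt nK N nΛ nσ
  | halt : SStmt nK N nΛ nσ
  deriving Countable

/-- The `TM2` statement denoted by a standard statement. [folklore] -/
def SStmt.toStmt {nK N nΛ nσ : ℕ} :
    SStmt nK N nΛ nσ → TM2.Stmt (fun _ : Fin nK => Fin (N + 1)) (Fin nΛ) (Fin nσ)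
  | .push k f q => .push k f q.toStmt
  | .peek k f q => .peek k f q.toStmt
  | .pop k f q => .pop k f q.toStmt
  | .load f q => .load f q.toStmt
  | .branch p q₁ q₂ => .branch p q₁.toStmt q₂.toStmt
  | .goto f => .goto f
  | .halt => .halt

/-- The code of a standard machine: the sizes, the input/output stacks, the main label, the
initial state and the program. [cite: AroraBarak2009, §1.4] -/
structure SCode where
  /-- number of stacks -/
  nK : ℕ
  /-- the shared stack alphabet is `Fin (N + 1)` -/
  N : ℕ
  /-- number of labels -/
  nΛ : ℕ
  /-- number of states -/
  nσ : ℕ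
  /-- input stack -/
  k₀ : Fin nK
  /-- output stack -/
  k₁ : Fin nK
  /-- main label -/
  main : Fin nΛ
  /-- initial state -/
  init : Fin nσ
  /-- the program -/
  prog : Fin nΛ → SStmt nK N nΛ nσ

/-- Codes of standard machines form a countable type. [cite: AroraBarak2009, §1.4] -/
instance : Countable SCode := by
  classical
  let F : SCode → Σ' (nK N nΛ nσ : ℕ), Fin nK × Fin nK × Fin nΛ × Fin nσ × (Fin nΛ → SStmt nK N nΛ nσ) :=
    fun c => ⟨c.nK, c.N, c.nΛ, c.nσ, c.k₀, c.k₁, c.main, c.init, c.prog⟩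
  have hF : Injective F := by
    rintro ⟨nK, N, nΛ, nσ, k₀, k₁, main, init, prog⟩ ⟨nK', N', nΛ', nσ', k₀', k₁', main', init', prog'⟩ h
    simp only [F] at h
    obtain ⟨rfl, h⟩ := PSigma.mk.inj h
    obtain ⟨rfl, h⟩ := PSigma.mk.inj (eq_of_heq h)
    obtain ⟨rfl, h⟩ := PSigma.mk.inj (eq_of_heq h)
    obtain ⟨rfl, h⟩ := PSigma.mk.inj (eq_of_heq h)
    have h' := eq_of_heq h
    simp only [Prod.mk.injEq] at h'
    obtain ⟨rfl, rfl, rfl, rfl, rfl⟩ := h'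
    rfl
  exact hF.countable

/-- The bundled machine of a code (reducible, so that its alphabet `fun _ => Fin (N + 1)`
computes by unfolding). [cite: AroraBarak2009, §1.4] -/
@[reducible] def SCode.tm (c : SCode) : FinTM2 where
  K := Fin c.nK
  k₀ := c.k₀
  k₁ := c.k₁
  Γ := fun _ => Fin (c.N + 1)
  Λ := Fin c.nΛ
  main := c.main
  σ := Fin c.nσ
  initialState := c.init
  m := fun l => (c.prog l).toStmt

/-! ### Determinism: the output word is unique -/

section Unique

variable {S : Type*}

/-- A halted run stays where it is: from a fixed point‐free `none`, iteration is `none`. [folklore] -/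
theorem iterate_bind_of_none (f : S → Option S) {c : S} (hc : f c = none) :
    ∀ n, (flip bind f)^[n + 1] (some c) = none := by
  intro n
  rw [TM2Comp.iterate_bind_succ, hc, TM2Comp.iterate_bind_none]

/-- **Determinism.** Two halting configurations (ones on which the step function is `none`)
reached from the same start coincide. [folklore] -/
theorem iterate_bind_unique (f : S → Option S) {a c₁ c₂ : S} {n₁ n₂ : ℕ}
    (h₁ : (flip bind f)^[n₁] (some a) = some c₁) (h₂ : (flip bind f)^[n₂] (some a) = some c₂)
    (hc₁ : f c₁ = none) (hc₂ : f c₂ = none) : c₁ = c₂ := by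
  wlog h : n₁ ≤ n₂ generalizing n₁ n₂ c₁ c₂
  · exact (this h₂ h₁ hc₂ hc₁ (le_of_not_ge h)).symm
  obtain ⟨d, rfl⟩ := Nat.exists_eq_add_of_le h
  rw [add_comm, iterate_add_apply, h₁] at h₂
  cases d with
  | zero => simpa using h₂
  | succ d => rw [iterate_bind_of_none f hc₁] at h₂; cases h₂

/-- The halting configuration of `haltList` is a fixed point of the step function. [folklore] -/
theorem step_haltList (tm : FinTM2) (s : List (tm.Γ tm.k₁)) : tm.step (haltList tm s) = none := by
  rw [TM2Comp.haltList_eq]; rfl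

/-- `haltList` is injective: the output word is the content of the output stack. [folklore] -/
theorem haltList_injective (tm : FinTM2) : Injective (haltList tm) := by
  intro s s' h
  rw [TM2Comp.haltList_eq, TM2Comp.haltList_eq] at h
  have := congrArg (fun c : tm.Cfg => c.stk tm.k₁) h
  simpa using this

/-- **A machine has at most one output word on a given input.** [folklore] -/
theorem outputs_unique (tm : FinTM2) {l : List (tm.Γ tm.k₀)} {l₁ l₂ : List (tm.Γ tm.k₁)}
    {m₁ m₂ : ℕ} (h₁ : Nonempty (TM2OutputsInTime tm l (some l₁) m₁))
    (h₂ : Nonempty (TM2OutputsInTime tm l (some l₂) m₂)) : l₁ = l₂ := by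
  obtain ⟨e₁⟩ := h₁
  obtain ⟨e₂⟩ := h₂
  have k₁ := e₁.evals_in_steps
  have k₂ := e₂.evals_in_steps
  simp only [Option.map_some] at k₁ k₂
  exact haltList_injective tm
    (iterate_bind_unique tm.step k₁ k₂ (step_haltList tm l₁) (step_haltList tm l₂))

end Unique

/-! ### Allowed symbols of a machine -/

section Allowed

variable {K : Type} {Γ : K → Type} {Λ σ : Type}

/-- The symbols (with their stack) pushed by some `push` instruction of a statement. [folklore] -/
def pushSyms : TM2.Stmt Γ Λ σ → Set (Σ k, Γ k)
  | .push k f q => Set.range (fun s => (⟨k, f s⟩ : Σ k, Γ k)) ∪ pushSyms q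
  | .peek _ _ q => pushSyms q
  | .pop _ _ q => pushSyms q
  | .load _ q => pushSyms q
  | .branch _ q₁ q₂ => pushSyms q₁ ∪ pushSyms q₂
  | .goto _ => ∅
  | .halt => ∅

/-- A statement over a finite state type pushes finitely many symbols. [folklore] -/
theorem pushSyms_finite [Finite σ] : ∀ q : TM2.Stmt Γ Λ σ, (pushSyms q).Finite
  | .push _ _ q => (Set.finite_range _).union (pushSyms_finite q)
  | .peek _ _ q => pushSyms_finite q
  | .pop _ _ q => pushSyms_finite q
  | .load _ q => pushSyms_finite q
  | .branch _ q₁ q₂ => (pushSyms_finite q₁).union (pushSyms_finite q₂)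
  | .goto _ => Set.finite_empty
  | .halt => Set.finite_empty

end Allowed

variable (tm : FinTM2)

/-- The **allowed symbols** of a machine: every symbol of the input stack, and every symbol
pushed by some instruction of the program. Runs from `initList` only ever see allowed symbols
(`StkOK`). [folklore] -/
def allowed : Set (Σ k, tm.Γ k) :=
  Set.range (fun γ : tm.Γ tm.k₀ => (⟨tm.k₀, γ⟩ : Σ k, tm.Γ k)) ∪ ⋃ l, pushSyms (tm.m l)

/-- The allowed symbols form a finite set. [folklore] -/
theorem allowed_finite : (allowed tm).Finite := by
  letI := tm.ΛFin; letI := tm.σFin; letI := tm.Γk₀Fin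
  exact (Set.finite_range _).union (Set.finite_iUnion fun l => pushSyms_finite (tm.m l))

/-- All symbols on all stacks are allowed. [folklore] -/
def StkOK (S : ∀ k, List (tm.Γ k)) : Prop := ∀ k, ∀ γ ∈ S k, (⟨k, γ⟩ : Σ k, tm.Γ k) ∈ allowed tm

/-! ### The numbering of allowed symbols and the relabelling bijections -/

/-- `Fintype` structure on the allowed symbols. [folklore] -/
@[reducible] noncomputable def finAllowed : Fintype ↥(allowed tm) := (allowed_finite tm).fintype

/-- The number `N` of allowed symbols; the standard machine uses the alphabet `Fin (N + 1)`
(`0` is unused). [folklore] -/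
noncomputable def stdN : ℕ := @Fintype.card _ (finAllowed tm)

/-- A bijection between the allowed symbols and `Fin N`. [folklore] -/
noncomputable def encA : ↥(allowed tm) ≃ Fin (stdN tm) := @Fintype.equivFin _ (finAllowed tm)

open scoped Classical in
/-- The code of a symbol: allowed symbols are numbered `1, …, N`, all other symbols get `0`. [folklore] -/
noncomputable def enc (x : Σ k, tm.Γ k) : Fin (stdN tm + 1) :=
  if h : x ∈ allowed tm then (encA tm ⟨x, h⟩).succ else 0

/-- Decoding a code into an allowed symbol (`none` on `0`). [folklore] -/
noncomputable def dec (j : Fin (stdN tm + 1)) : Option (Σ k, tm.Γ k) :=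
  if h : j = 0 then none else some ((encA tm).symm (j.pred h)).1

/-- Decoding recovers allowed symbols. [folklore] -/
theorem dec_enc {x : Σ k, tm.Γ k} (hx : x ∈ allowed tm) : dec tm (enc tm x) = some x := by
  unfold dec enc
  rw [dif_pos hx, dif_neg (Fin.succ_ne_zero _)]
  simp

/-- Decoding the (optional) top code of stack `k` into an (optional) symbol of stack `k`. [folklore] -/
noncomputable def decOpt (k : tm.K) : Option (Fin (stdN tm + 1)) → Option (tm.Γ k)
  | none => none
  | some j => match dec tm j with
    | none => none
    | some x => if h : x.1 = k then some (h ▸ x.2) else none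

/-- Decoding the code of an allowed symbol of stack `k` gives it back. [folklore] -/
theorem decOpt_enc {k : tm.K} {γ : tm.Γ k} (h : (⟨k, γ⟩ : Σ k, tm.Γ k) ∈ allowed tm) :
    decOpt tm k (some (enc tm ⟨k, γ⟩)) = some γ := by
  simp only [decOpt, dec_enc tm h, dite_true]

/-- Number of stacks. [folklore] -/
noncomputable def nK : ℕ := @Fintype.card tm.K tm.kFin

/-- Number of labels. [folklore] -/
noncomputable def nΛ : ℕ := @Fintype.card tm.Λ tm.ΛFin

/-- Number of states. [folklore] -/
noncomputable def nσ : ℕ := @Fintype.card tm.σ tm.σFin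

/-- Numbering of the stacks. [folklore] -/
noncomputable def eK : tm.K ≃ Fin (nK tm) := @Fintype.equivFin tm.K tm.kFin

/-- Numbering of the labels. [folklore] -/
noncomputable def eΛ : tm.Λ ≃ Fin (nΛ tm) := @Fintype.equivFin tm.Λ tm.ΛFin

/-- Numbering of the states. [folklore] -/
noncomputable def eσ : tm.σ ≃ Fin (nσ tm) := @Fintype.equivFin tm.σ tm.σFin

/-! ### The standard machine of a machine -/

/-- Translation of statements: stacks, labels and states are renumbered; `push` pushes the code
of the pushed symbol; `peek`/`pop` decode the top code before calling the original transition.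
[cite: AroraBarak2009, §1.4] -/
noncomputable def trStmt : TM2.Stmt tm.Γ tm.Λ tm.σ → SStmt (nK tm) (stdN tm) (nΛ tm) (nσ tm)
  | .push k f q => .push (eK tm k) (fun s => enc tm ⟨k, f ((eσ tm).symm s)⟩) (trStmt q)
  | .peek k f q =>
      .peek (eK tm k) (fun s o => eσ tm (f ((eσ tm).symm s) (decOpt tm k o))) (trStmt q)
  | .pop k f q =>
      .pop (eK tm k) (fun s o => eσ tm (f ((eσ tm).symm s) (decOpt tm k o))) (trStmt q)
  | .load f q => .load (fun s => eσ tm (f ((eσ tm).symm s))) (trStmt q)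
  | .branch p q₁ q₂ => .branch (fun s => p ((eσ tm).symm s)) (trStmt q₁) (trStmt q₂)
  | .goto f => .goto (fun s => eΛ tm (f ((eσ tm).symm s)))
  | .halt => .halt

/-- **The standard machine** simulating `tm`. [cite: AroraBarak2009, §1.4] -/
@[reducible] noncomputable def stdCode : SCode where
  nK := nK tm
  N := stdN tm
  nΛ := nΛ tm
  nσ := nσ tm
  k₀ := eK tm tm.k₀
  k₁ := eK tm tm.k₁
  main := eΛ tm tm.main
  init := eσ tm tm.initialState
  prog := fun l => trStmt tm (tm.m ((eΛ tm).symm l))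

/-- Coding a stack of symbols of stack `k`. [folklore] -/
noncomputable def stkCode (k : tm.K) (L : List (tm.Γ k)) : List (Fin (stdN tm + 1)) :=
  L.map fun γ => enc tm ⟨k, γ⟩

/-- Coding a stack assignment (stacks renumbered along `eK`). [folklore] -/
noncomputable def trStk (S : ∀ k, List (tm.Γ k)) : Fin (nK tm) → List (Fin (stdN tm + 1)) :=
  fun k' => stkCode tm ((eK tm).symm k') (S ((eK tm).symm k'))

/-- Coding a configuration. [folklore] -/
noncomputable def trCfg (c : tm.Cfg) : (stdCode tm).tm.Cfg :=
  ⟨c.l.map (eΛ tm), eσ tm c.var, trStk tm c.stk⟩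

/-- The coded stack assignment at the renumbered index. [folklore] -/
theorem trStk_apply (S : ∀ k, List (tm.Γ k)) (k : tm.K) :
    trStk tm S (eK tm k) = stkCode tm k (S k) := by
  unfold trStk
  rw [Equiv.symm_apply_apply]

/-- Coding commutes with writing a stack. [folklore] -/
theorem trStk_update (S : ∀ k, List (tm.Γ k)) (k : tm.K) (L : List (tm.Γ k)) :
    trStk tm (update S k L) = update (trStk tm S) (eK tm k) (stkCode tm k L) := by
  funext k'
  by_cases h : k' = eK tm k
  · subst h
    rw [update_self, trStk_apply, update_self]
  · rw [update_of_ne h]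
    unfold trStk
    have hk : (eK tm).symm k' ≠ k := fun h' => h (by rw [← h', Equiv.apply_symm_apply])
    rw [update_of_ne hk]

/-- Decoding the top of a coded stack of allowed symbols. [folklore] -/
theorem decOpt_head {k : tm.K} {L : List (tm.Γ k)}
    (hL : ∀ γ ∈ L, (⟨k, γ⟩ : Σ k, tm.Γ k) ∈ allowed tm) :
    decOpt tm k (stkCode tm k L).head? = L.head? := by
  cases L with
  | nil => rfl
  | cons γ L => exact decOpt_enc tm (hL γ (by simp))

/-! ### One-step simulation -/

/-- **Simulation of one statement**: on a configuration with allowed symbols only, executing the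
translated statement on the coded configuration gives the coded result, and the result again has
allowed symbols only. [cite: AroraBarak2009, §1.4] -/
theorem stepAux_tr : ∀ (q : TM2.Stmt tm.Γ tm.Λ tm.σ), pushSyms q ⊆ allowed tm →
    ∀ (v : tm.σ) (S : ∀ k, List (tm.Γ k)), StkOK tm S →
      TM2.stepAux (trStmt tm q).toStmt (eσ tm v) (trStk tm S) = trCfg tm (TM2.stepAux q v S) ∧
        StkOK tm (TM2.stepAux q v S).stk
  | .push k f q, hq, v, S, hS => by
    have hq' : pushSyms q ⊆ allowed tm := fun x hx => hq (Or.inr hx)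
    have hfv : (⟨k, f v⟩ : Σ k, tm.Γ k) ∈ allowed tm := hq (Or.inl ⟨v, rfl⟩)
    have hS' : StkOK tm (update S k (f v :: S k)) := by
      intro k' γ hγ
      by_cases hk : k' = k
      · subst hk
        rw [update_self, List.mem_cons] at hγ
        rcases hγ with rfl | hγ
        · exact hfv
        · exact hS _ γ hγ
      · rw [update_of_ne hk] at hγ
        exact hS _ γ hγ
    have ih := stepAux_tr q hq' v (update S k (f v :: S k)) hS'
    simp only [trStmt, SStmt.toStmt, TM2.stepAux, Equiv.symm_apply_apply]
    rw [trStk_update] at ih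
    rw [trStk_apply]
    exact ih
  | .peek k f q, hq, v, S, hS => by
    have ih := stepAux_tr q hq (f v (S k).head?) S hS
    simp only [trStmt, SStmt.toStmt, TM2.stepAux, Equiv.symm_apply_apply]
    rw [trStk_apply, decOpt_head tm (hS k)]
    exact ih
  | .pop k f q, hq, v, S, hS => by
    have hS' : StkOK tm (update S k (S k).tail) := by
      intro k' γ hγ
      by_cases hk : k' = k
      · subst hk
        rw [update_self] at hγ
        exact hS _ γ (List.mem_of_mem_tail hγ)
      · rw [update_of_ne hk] at hγ
        exact hS _ γ hγ
    have ih := stepAux_tr q hq (f v (S k).head?) (update S k (S k).tail) hS'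
    simp only [trStmt, SStmt.toStmt, TM2.stepAux, Equiv.symm_apply_apply]
    rw [trStk_update] at ih
    rw [trStk_apply, decOpt_head tm (hS k)]
    have htail : (stkCode tm k (S k)).tail = stkCode tm k (S k).tail := by
      simp [stkCode, List.map_tail]
    rw [htail]
    exact ih
  | .load f q, hq, v, S, hS => by
    have ih := stepAux_tr q hq (f v) S hS
    simp only [trStmt, SStmt.toStmt, TM2.stepAux, Equiv.symm_apply_apply]
    exact ih
  | .branch p q₁ q₂, hq, v, S, hS => by
    have ih₁ := stepAux_tr q₁ (fun x hx => hq (Or.inl hx)) v S hS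
    have ih₂ := stepAux_tr q₂ (fun x hx => hq (Or.inr hx)) v S hS
    simp only [trStmt, SStmt.toStmt, TM2.stepAux, Equiv.symm_apply_apply]
    cases p v
    · exact ih₂
    · exact ih₁
  | .goto f, _, v, S, hS => by
    simp only [trStmt, SStmt.toStmt, TM2.stepAux, Equiv.symm_apply_apply]
    exact ⟨rfl, hS⟩
  | .halt, _, v, S, hS => by
    simp only [trStmt, SStmt.toStmt, TM2.stepAux]
    exact ⟨rfl, hS⟩

/-- **Simulation of one step.** [cite: AroraBarak2009, §1.4] -/
theorem step_tr (c d : tm.Cfg) (hc : StkOK tm c.stk) (h : tm.step c = some d) :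
    (stdCode tm).tm.step (trCfg tm c) = some (trCfg tm d) ∧ StkOK tm d.stk := by
  obtain ⟨_ | l, v, S⟩ := c
  · simp [FinTM2.step, TM2.step] at h
  · simp only [FinTM2.step, TM2.step] at h
    obtain rfl := Option.some.inj h
    have hq : pushSyms (tm.m l) ⊆ allowed tm := fun x hx => Or.inr (Set.mem_iUnion.2 ⟨l, hx⟩)
    have key := stepAux_tr tm (tm.m l) hq v S hc
    refine ⟨?_, key.2⟩
    change some (TM2.stepAux (trStmt tm (tm.m ((eΛ tm).symm (eΛ tm l)))).toStmt (eσ tm v)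
      (trStk tm S)) = some (trCfg tm (TM2.stepAux (tm.m l) v S))
    rw [Equiv.symm_apply_apply, key.1]
    rfl

/-- **Simulation of runs** (with the invariant). [cite: AroraBarak2009, §1.4] -/
theorem iterate_tr (n : ℕ) : ∀ c d : tm.Cfg, StkOK tm c.stk →
    (flip bind tm.step)^[n] (some c) = some d →
      (flip bind (stdCode tm).tm.step)^[n] (some (trCfg tm c)) = some (trCfg tm d) ∧
        StkOK tm d.stk := by
  induction n with
  | zero =>
    intro c d hc h
    simp only [iterate_zero, id_eq, Option.some.injEq] at h
    subst h
    exact ⟨rfl, hc⟩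
  | succ n ih =>
    intro c d hc h
    rw [TM2Comp.iterate_bind_succ] at h ⊢
    cases hfc : tm.step c with
    | none => rw [hfc, TM2Comp.iterate_bind_none] at h; cases h
    | some c' =>
      rw [hfc] at h
      obtain ⟨h1, h2⟩ := step_tr tm c c' hc hfc
      rw [h1]
      exact ih c' d h2 h

/-- The coded empty stack assignment is empty. [folklore] -/
theorem trStk_bot : trStk tm (fun _ => []) = fun _ => [] := by
  funext k'; simp [trStk, stkCode]

/-- Coding the initial configuration. [folklore] -/
theorem trCfg_initList (L : List (tm.Γ tm.k₀)) :
    trCfg tm (initList tm L) = initList (stdCode tm).tm (stkCode tm tm.k₀ L) := by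
  rw [TM2Comp.initList_eq, TM2Comp.initList_eq]
  simp only [trCfg, Option.map_some, trStk_update, trStk_bot]

/-- Coding the halting configuration. [folklore] -/
theorem trCfg_haltList (L : List (tm.Γ tm.k₁)) :
    trCfg tm (haltList tm L) = haltList (stdCode tm).tm (stkCode tm tm.k₁ L) := by
  rw [TM2Comp.haltList_eq, TM2Comp.haltList_eq]
  simp only [trCfg, Option.map_none, trStk_update, trStk_bot]

/-- The initial configuration has allowed symbols only. [folklore] -/
theorem stkOK_initList (L : List (tm.Γ tm.k₀)) : StkOK tm (initList tm L).stk := by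
  rw [TM2Comp.initList_eq]
  intro k γ hγ
  by_cases hk : k = tm.k₀
  · subst hk
    exact Or.inl ⟨γ, rfl⟩
  · simp [update_of_ne hk] at hγ

/-- **Outputs correspond.** If `tm` outputs `L'` on `L` within `m` steps, the standard machine
outputs the coded word on the coded input within `m` steps, and the output symbols are allowed.
[cite: AroraBarak2009, §1.4] -/
theorem outputs_tr {L : List (tm.Γ tm.k₀)} {L' : List (tm.Γ tm.k₁)} {m : ℕ}
    (h : Nonempty (TM2OutputsInTime tm L (some L') m)) :
    Nonempty (TM2OutputsInTime (stdCode tm).tm (stkCode tm tm.k₀ L)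
      (some (stkCode tm tm.k₁ L')) m) ∧
      ∀ γ ∈ L', (⟨tm.k₁, γ⟩ : Σ k, tm.Γ k) ∈ allowed tm := by
  obtain ⟨⟨⟨steps, hev⟩, hle⟩⟩ := h
  simp only [Option.map_some] at hev
  obtain ⟨h1, h2⟩ := iterate_tr tm steps (initList tm L) (haltList tm L') (stkOK_initList tm L) hev
  refine ⟨⟨⟨⟨steps, ?_⟩, hle⟩⟩, ?_⟩
  · simp only [Option.map_some]
    rw [← trCfg_initList, ← trCfg_haltList]
    exact h1
  · intro γ hγ
    have := h2 tm.k₁ γ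
    rw [TM2Comp.haltList_eq] at this
    exact this (by simpa using hγ)

/-! ### Countability of the computed functions -/

/-- A standard machine together with a coding of the input alphabet `Γ₀` and a partial decoding of
codes into the output alphabet `Γ₁`. [cite: AroraBarak2009, §1.4] -/
structure StdIndex (Γ₀ Γ₁ : Type) where
  /-- the standard machine -/
  code : SCode
  /-- coding of input symbols -/
  inp : Γ₀ → Fin (code.N + 1)
  /-- decoding of output codes -/
  out : Fin (code.N + 1) → Option Γ₁

/-- For a finite input alphabet and a countable output alphabet the indices form a countable
type. [cite: AroraBarak2009, §1.4] -/
instance {Γ₀ Γ₁ : Type} [Finite Γ₀] [Countable Γ₁] : Countable (StdIndex Γ₀ Γ₁) := by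
  let F : StdIndex Γ₀ Γ₁ → Σ c : SCode, (Γ₀ → Fin (c.N + 1)) × (Fin (c.N + 1) → Option Γ₁) :=
    fun i => ⟨i.code, i.inp, i.out⟩
  have hF : Injective F := by
    rintro ⟨c, inp, out⟩ ⟨c', inp', out'⟩ h
    simp only [F] at h
    obtain ⟨rfl, h⟩ := Sigma.mk.inj h
    have h' := eq_of_heq h
    simp only [Prod.mk.injEq] at h'
    obtain ⟨rfl, rfl⟩ := h'
    rfl
  exact hF.countable

variable {tm}
variable {Γ₀ Γ₁ : Type}

/-- `i.Computes x y`: the standard machine of `i`, on the coded input `x`, halts with an output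
word decoding to `y`. [cite: AroraBarak2009, §1.4] -/
def StdIndex.Computes (i : StdIndex Γ₀ Γ₁) (x : List Γ₀) (y : List Γ₁) : Prop :=
  ∃ (m : ℕ) (L' : List (Fin (i.code.N + 1))),
    Nonempty (TM2OutputsInTime i.code.tm (x.map i.inp) (some L') m) ∧ L'.map i.out = y.map some

/-- `Computes` is functional (determinism). [folklore] -/
theorem StdIndex.computes_unique {i : StdIndex Γ₀ Γ₁} {x : List Γ₀} {y₁ y₂ : List Γ₁}
    (h₁ : i.Computes x y₁) (h₂ : i.Computes x y₂) : y₁ = y₂ := by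
  obtain ⟨m₁, L₁, hL₁, hy₁⟩ := h₁
  obtain ⟨m₂, L₂, hL₂, hy₂⟩ := h₂
  have hL : L₁ = L₂ := outputs_unique i.code.tm hL₁ hL₂
  subst hL
  rw [hy₁] at hy₂
  exact (List.map_injective_iff.2 (Option.some_injective _)) hy₂

/-- **The index of a machine**: its standard machine, the coding of input symbols through the
input-alphabet identification, and the decoding of output codes through the output-alphabet
identification. [cite: AroraBarak2009, §1.4] -/
@[reducible] noncomputable def stdIndex (M : TM2ComputableAux Γ₀ Γ₁) : StdIndex Γ₀ Γ₁ where
  code := stdCode M.tm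
  inp := fun g => enc M.tm ⟨M.tm.k₀, M.inputAlphabet.symm g⟩
  out := fun j => (decOpt M.tm M.tm.k₁ (some j)).map M.outputAlphabet

/-- **The index computes what the machine computes.** [cite: AroraBarak2009, §1.4] -/
theorem computes_stdIndex (M : TM2ComputableAux Γ₀ Γ₁) {x : List Γ₀} {y : List Γ₁} {m : ℕ}
    (h : M.OutputsWithin x y m) : (stdIndex M).Computes x y := by
  obtain ⟨h1, h2⟩ := outputs_tr M.tm h
  have hx : x.map (stdIndex M).inp = stkCode M.tm M.tm.k₀ (x.map M.inputAlphabet.symm) := by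
    simp only [stdIndex, stkCode, List.map_map]
    rfl
  refine ⟨m, stkCode M.tm M.tm.k₁ (y.map M.outputAlphabet.symm), ?_, ?_⟩
  · rw [hx]
    exact h1
  · have hy : (stkCode M.tm M.tm.k₁ (y.map M.outputAlphabet.symm)).map (stdIndex M).out =
        y.map (fun g => (stdIndex M).out (enc M.tm ⟨M.tm.k₁, M.outputAlphabet.symm g⟩)) := by
      simp only [stkCode, List.map_map]
      rfl
    rw [hy]
    refine List.map_congr_left fun g hg => ?_
    change (decOpt M.tm M.tm.k₁ (some (enc M.tm ⟨M.tm.k₁, M.outputAlphabet.symm g⟩))).map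
      M.outputAlphabet = some g
    rw [decOpt_enc M.tm (h2 _ (List.mem_map.2 ⟨g, hg, rfl⟩))]
    simp

end TM2Std

/-! ### The countability theorems -/

section Countable

open TM2Std

variable {α β Γ₀ Γ₁ : Type}

/-- **Machine-computable functions form a countable set**: for a finite input alphabet, a
countable output alphabet and an injective output encoder, the functions `f : α → β` computed by
*some* `TM2` machine within *some* time bound form a countable set ("every Turing machine can be
represented as a string", Arora–Barak 2009, §1.4, for Mathlib's `Turing.FinTM2`). The
hypotheses on `Γ₁` and `eb` are needed: with an uncountable `Γ₁` the constant functions already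
give uncountably many computable functions; the input alphabet, on the other hand, is finite as
soon as one machine exists (`FinTM2.Γk₀Fin` and `inputAlphabet`). [cite: AroraBarak2009, §1.4] -/
theorem countable_setOf_timeComputable [Countable Γ₁] (ea : α → List Γ₀)
    {eb : β → List Γ₁} (heb : Injective eb) :
    Set.Countable {f : α → β | ∃ t : ℕ → ℕ, TimeComputable ea eb f t} := by
  by_cases hne : {f : α → β | ∃ t : ℕ → ℕ, TimeComputable ea eb f t}.Nonempty
  · -- some machine exists, so the input alphabet is finite
    obtain ⟨f₀, t₀, M₀, -⟩ := hne
    haveI : Finite Γ₀ := by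
      letI := M₀.tm.Γk₀Fin
      exact Finite.of_equiv _ M₀.inputAlphabet
    let T : StdIndex Γ₀ Γ₁ → Set (α → β) := fun i => {f | ∀ a, i.Computes (ea a) (eb (f a))}
    have hT : ∀ i, (T i).Subsingleton := by
      intro i f hf g hg
      funext a
      exact heb (StdIndex.computes_unique (hf a) (hg a))
    have hcover : {f : α → β | ∃ t : ℕ → ℕ, TimeComputable ea eb f t} ⊆ ⋃ i, T i := by
      rintro f ⟨t, M, hM⟩
      exact Set.mem_iUnion.2 ⟨stdIndex M, fun a => computes_stdIndex M (hM a)⟩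
    exact (Set.countable_iUnion fun i => (hT i).countable).mono hcover
  · rw [Set.not_nonempty_iff_eq_empty.1 hne]
    exact Set.countable_empty

/-- **Polynomial-time computable functions form a countable set.** [cite: AroraBarak2009, §1.4] -/
theorem countable_setOf_polyTimeComputable [Countable Γ₁] (ea : α → List Γ₀)
    {eb : β → List Γ₁} (heb : Injective eb) :
    Set.Countable {f : α → β | PolyTimeComputable ea eb f} :=
  (countable_setOf_timeComputable ea heb).mono fun f hf => by
    obtain ⟨p, hp⟩ := (hf : PolyTimeComputable ea eb f)
    exact ⟨_, hp⟩

/-- **There are countably many polynomial-time oracle algorithms** (an oracle algorithm of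
`Oracle.lean` *is* its step function, and `OracleAlg.IsPolyTime` asks for a polynomial-time
machine computing it over the alphabet `{0,1}` with an injective output encoding): the
enumeration `M₁, M₂, …` of polynomial-time oracle machines used in every oracle construction
(Baker–Gill–Solovay 1975, §1; Ko 1989, §3). [cite: BakerGillSolovay1975, §1] [cite: AroraBarak2009, §1.4] -/
theorem countable_setOf_isPolyTime {δ : Type} (eb : Computability.Encoding δ Bool) :
    Set.Countable {M : OracleAlg δ | M.IsPolyTime eb} := by
  have h := countable_setOf_polyTimeComputable (α := List Bool × List (List Bool))
    (β := List Bool ⊕ δ)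
    (fun p => boolPair p.1 ((Computability.encodingList Bool).listBool.encode p.2))
    (eb := ((Computability.encodingList Bool).sumBool eb).encode) (Computability.Encoding.encode_injective _)
  refine Set.MapsTo.countable_of_injOn (f := fun M : OracleAlg δ => Function.uncurry M.step)
    (fun M hM => hM) ?_ h
  rintro ⟨s⟩ - ⟨s'⟩ - hss
  have : s = s' := by
    funext x ans
    exact congrFun hss (x, ans)
  subst this
  rfl

end Countable


end Literature.Computability.Complexity
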